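import Literature.MathematicalPhysics.QuantumFieldTheory.Balaban1983to89.B9Eq341TowerBlockGeometry
import Literature.MathematicalPhysics.QuantumFieldTheory.Balaban1983to89.B4Sect5Proof
import Literature.MathematicalPhysics.QuantumFieldTheory.Balaban1983to89.B6DomainMajorant
import Literature.MathematicalPhysics.QuantumFieldTheory.Balaban1983to89.B9Thm314ResolventCore

/-!
# `Balaban1983to89.B9Eq367TowerResolventStep` — T. Bałaban, *Propagators for lattice gauge theories in a background field*, Commun. Math. Phys. **99** (1985) 389–434
# [Balaban1985BackgroundPropagators] (3.65)–(3.67) p. 403 («Using Theorem 3.2 and the above bound we obtain Q′(U′U)G′²(U′U)Q′*(U′U) = (I + C′(A)(Q′(U)G′²(U)Q′*(U))⁻¹)·Q′(U)G′²(U)Q′*(U) … thus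
# the operators in the equality are invertible … The inverse satisfies Theorem 3.2»), Thm 3.2 (3.48) p. 398, with [Balaban1984PropagatorsII] (2.52)–(2.55) p. 232, (2.66) p. 234: **THE RESOLVENT
# STEP OF THE THIRD-OPERATOR STOREY ON BLOCK MAJORANTS OVER `towerGeom`** — if two operators `X(U)`, `X(1)` of one carrier have inverses `c(U)` (left) and `c(1)` (right) with block majorants
# `K_c e^{−δ_c d}`, and `X(U) − X(1) ≺ K_X·α·e^{−δ_X d}` (this lineage's `B9Eq365TowerQGGQWordLadder` for the chain's `Q̃′G′²Q̃′†`), then the second resolvent identity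
# `c(U) − c(1) = c(U)(X(1) − X(U))c(1)` and two (2.66)-products give **`c(U) − c(1) ≺ K_c²K_X c₁² · α · e^{−(min(δ_c,δ_X)∕2) d}`** — the two-background ladder passes from the word to its
# inverse with constants before the lattice (the rows of `c_k(U)`, `c_k(1)` are the NEXT input: leaf-03's `B9Eq349ConjugatedQGGQInvSupRowTower` through `B9Eq342MajorantReadingSeam`)

statement-level skeleton of published theorems with citation tags; proofs where landed; nothing here is a claim about the Yang–Mills mass gap

CITATION HEADER (lean-in-tree rule).  Audit cell `pub-balaban`, sub-cell `t4`, BINDER row NE9; NE9 crux-team LEAF PROVER 01 (`b2b-balaban-t4-ne9-formalise-leaf-01`,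
gen 99; bears_on: R4/N22).  Vocabulary BY NAME: `B6DomainMajorant.hasMajorant_neg`, `B9Thm314ResolventCore.sub_eq_mul_sub_mul`, pv08's `B6RandomWalk.HasMajorant` ∕ `hasMajorant_mono` ∕ `majorant_G0_mul_265` ∕ `c1_nonneg`, `B4Sect5Proof.weaken`, this lineage's
`B9Eq341TowerBlockGeometry.towerGeom` ∕ `htri_towerGeom` ∕ `h261_towerGeom` ∕ `hdnn_towerGeom`, `B9Thm34Ext.toB6`.  Sources read through those files' verbatim quotations:
[Balaban1985BackgroundPropagators] pp. 398, 403; [Balaban1984PropagatorsII] pp. 232, 234.  [folklore] the second resolvent identity; COMPOSITION BY NAME; NOTHING of print's proofs is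
reproduced beyond what the named files prove (print runs a Neumann series at `U`; at the base `U₀ = 1` with BOTH inverses in hand the resolvent identity suffices).

WHAT IS PROVED (sorry-free; proof lane — no `def`).
* **`hasMajorant_inv_sub_inv`** (with `B6DomainMajorant.hasMajorant_neg` and `B9Thm314ResolventCore.sub_eq_mul_sub_mul` — the sign and the resolvent identity
  `c(U) − c(1) = c(U)(X(1) − X(U))c(1)`; the Thm-3.14 core `B9Thm314ResolventCore.hasMajorant_inv_sub_inv_core` is the detour-weighted cousin at rates `(δ, 2δ) ↦ δ∕3`) — the resolvent step on block majorants over `towerGeom` (any carrier `X`, any block map): `c(U) − c(1) ≺ K_cK_XK_c·c₁(d, δ⋆, ½)²·α·e^{−(δ⋆∕2) d}`, `δ⋆ = min(δ_c, δ_X)`.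
HONEST SCOPE.  Bookkeeping ([4] (2.66) twice); constants crude (NOT print's); the inputs (inverse rows at `U` and at `1`, the word ladder) are hypotheses here; NE9 NOT PRINTED ∕ NOT PROVED; spine
PROVED 0∕9; rung (B)+1 finite T⁴ — NOT infinite volume, NOT mass gap, NOT BetaPertH, NOT Clay.  HONEST DEPENDENCY: continuum YM on T⁴ ⇐ BetaPertH ∧ nine spine estimates (0/9 proved);
BetaPertH ⇐ (D1) ∧ (D4) ∧ CAP+tail; G-an2-4 gates asym, D1 and NE2/3/4.  NEW file; nothing modified.  Net new unproved facts: 0.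
-/

noncomputable section

open scoped BigOperators

namespace Literature.MathematicalPhysics.QuantumFieldTheory.Balaban1983to89.B9Eq367TowerResolventStep

open B4Sect5Torus (TSite)
open B6RandomWalk (HasMajorant hasMajorant_mono majorant_G0_mul_265 c1_nonneg)
open B4Sect5Proof (weaken)
open B9Thm34Ext (toB6)
open B9Eq341TowerBlockGeometry (towerGeom htri_towerGeom h261_towerGeom hdnn_towerGeom)
open B6DomainMajorant (hasMajorant_neg)
open B9Thm314ResolventCore (sub_eq_mul_sub_mul)

/-! ## The resolvent step on block majorants over `towerGeom` -/

section Step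

variable {d : ℕ} (L : ℕ) (m : Fin d → ℕ) [∀ i, NeZero (m i)] (n : ℕ) (η M Rr : ℝ) (H : Prop) {X : Type} (blk : X → TSite d m)

/-- **THE RESOLVENT STEP, LATTICE-UNIFORMLY**: over the one-scale geometry `towerGeom` (where [4] (2.61) holds at every rate and (2.54) is the `ℓ¹` triangle inequality), inverses
`c(U)` (left, of `X(U)`) and `c(1)` (right, of `X(1)`) with block majorants `K_c e^{−δ_c d}` and a word ladder `X(U) − X(1) ≺ K_X·α·e^{−δ_X d}` give
`c(U) − c(1) ≺ K_c·c₁·(K_X·c₁·α·K_c)·e^{−(δ⋆∕2) d}`, `δ⋆ = min(δ_c, δ_X)`, `c₁ = c₁(d, δ⋆, ½)` — every constant independent of the lattice.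
[cite: Balaban1985BackgroundPropagators, (3.65)–(3.67) p.403, Thm 3.2 (3.48) p.398; Balaban1984PropagatorsII, (2.52)–(2.55) p.232, (2.66) p.234] -/
theorem hasMajorant_inv_sub_inv {cU c1 XU X1 : Module.End ℝ (X → ℝ)} {Kc KX δc δX α : ℝ}
    (hKc : 0 ≤ Kc) (hKX : 0 ≤ KX) (hα : 0 ≤ α) (hδc : 0 < δc) (hδX : 0 < δX)
    (hinvU : cU * XU = 1) (hinv1 : X1 * c1 = 1)
    (hcU : HasMajorant (g := toB6 (towerGeom L m n η M) Rr H) blk cU (fun a a' => Kc * Real.exp (-(δc * (towerGeom L m n η M).dist a a'))))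
    (hc1 : HasMajorant (g := toB6 (towerGeom L m n η M) Rr H) blk c1 (fun a a' => Kc * Real.exp (-(δc * (towerGeom L m n η M).dist a a'))))
    (hX : HasMajorant (g := toB6 (towerGeom L m n η M) Rr H) blk (XU - X1) (fun a a' => KX * α * Real.exp (-(δX * (towerGeom L m n η M).dist a a')))) :
    HasMajorant (g := toB6 (towerGeom L m n η M) Rr H) blk (cU - c1)
      (fun a a' => Kc * B6.c1 d (min δc δX) (1 / 2) * (KX * B6.c1 d (min δc δX) (1 / 2) * α * Kc) *
        Real.exp (-(min δc δX / 2 * (towerGeom L m n η M).dist a a'))) := by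
  have hδ0 : 0 < min δc δX := lt_min hδc hδX
  have hdnn := hdnn_towerGeom L m n η M
  have htri := htri_towerGeom L m n η M Rr H
  have h261 := h261_towerGeom L m n η M Rr H (by norm_num : (0 : ℝ) < 1 / 2) hδ0
  have hαδ : 0 ≤ (1 - 1 / 2) * min δc δX := by linarith [hδ0.le]
  rw [sub_eq_mul_sub_mul hinvU hinv1, mul_assoc]
  -- the factors at the common rates
  have hXn : HasMajorant (g := toB6 (towerGeom L m n η M) Rr H) blk (X1 - XU)
      (fun a a' => KX * α * Real.exp (-(min δc δX * (towerGeom L m n η M).dist a a'))) := by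
    rw [← neg_sub]
    exact hasMajorant_mono _ (hasMajorant_neg (g := toB6 (towerGeom L m n η M) Rr H) blk hX) fun a a' => weaken (mul_nonneg hKX hα) le_rfl (min_le_right _ _) (hdnn a a')
  have hc1' : HasMajorant (g := toB6 (towerGeom L m n η M) Rr H) blk c1
      (fun a a' => Kc * Real.exp (-((1 - 1 / 2) * min δc δX * (towerGeom L m n η M).dist a a'))) :=
    hasMajorant_mono _ hc1 fun a a' => weaken hKc le_rfl (by linarith [min_le_left δc δX, hδ0.le]) (hdnn a a')
  have hcU' : HasMajorant (g := toB6 (towerGeom L m n η M) Rr H) blk cU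
      (fun a a' => Kc * (1 : ℝ) * Real.exp (-(min δc δX * (towerGeom L m n η M).dist a a'))) :=
    hasMajorant_mono _ hcU fun a a' => by rw [mul_one]; exact weaken hKc le_rfl (min_le_left _ _) (hdnn a a')
  -- (X(1) − X(U)) c(1), then c(U) ((X(1) − X(U)) c(1))
  have hP1 := majorant_G0_mul_265 (g := toB6 (towerGeom L m n η M) Rr H) blk d (min δc δX) (1 / 2) KX Kc (fun _ => α) hKX (fun _ => hα) hKc hαδ
    htri h261 hXn hc1'
  have hr1 : 0 ≤ KX * B6.c1 d (min δc δX) (1 / 2) * α * Kc := by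
    have := c1_nonneg d (min δc δX) (1 / 2); positivity
  have hP2 := majorant_G0_mul_265 (g := toB6 (towerGeom L m n η M) Rr H) blk d (min δc δX) (1 / 2) Kc (KX * B6.c1 d (min δc δX) (1 / 2) * α * Kc)
    (fun _ => (1 : ℝ)) hKc (fun _ => zero_le_one) hr1 hαδ htri h261 hcU' hP1
  refine hasMajorant_mono _ hP2 fun a a' => le_of_eq ?_
  show Kc * B6.c1 d (min δc δX) (1 / 2) * 1 * (KX * B6.c1 d (min δc δX) (1 / 2) * α * Kc) *
      Real.exp (-((1 - 1 / 2) * min δc δX * (towerGeom L m n η M).dist a a')) = _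
  rw [mul_one, show ((1 : ℝ) - 1 / 2) * min δc δX = min δc δX / 2 by ring]

end Step

end Literature.MathematicalPhysics.QuantumFieldTheory.Balaban1983to89.B9Eq367TowerResolventStep

end
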